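import Mathlib.MeasureTheory.Function.FactorsThrough
import Literature.Probability.Moments.CovarianceFreezing
import Summits.QuantumFields.YangMills.Theses.FradkinShenkerFlow
import Summits.QuantumFields.YangMills.Theorems.FradkinShenkerFlowElitzurLinkCovariance
import Summits.QuantumFields.YangMills.Theorems.FradkinShenkerFlowSusceptibilityToPoincareTwoBlockFactorization

/-!
# Stub `stub_elitzurBessel` of the line `planted-link-pinning` (crux `SusceptibilityToPoincare`)

Route `FradkinShenkerFlow` of `YangMills`, crux item `stmt-QuantumFields-9441`
(`Summit.QuantumFields.YangMills.Theses.FradkinShenkerFlow.SusceptibilityToPoincare`, FS ⇒ UP),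
line `planted-link-pinning`, stub S2 `stub_elitzurBessel` — the density-zero anchor "EB" of the
planted link-pinning localisation: the UNPINNED torus Wilson measure
`μ = wilsonMeasure r.ρ β` on `GaugeConfig 4 (2S+1) G = (Edge → G)` is spectrally independent with
the product-measure constant,

  `Σ_ℓ Var_μ (E_μ[φ | σ(U_ℓ)]) ≤ Var_μ φ`

for every bounded measurable `φ`, every compact `G`, every real `β` and every side `2S+1 ≥ 3`.
The statement is provided in the two registered currencies of the line: directly over
`wilsonMeasure (d := 4) (L := 2S+1) r.ρ β` (`ElitzurBessel.stub_elitzurBessel`, skeleton v2) and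
with the measure introduced by a binder `μW = wilsonMeasure r.ρ β →` (`stub_elitzurBessel`,
skeleton v1); the second is the first after `subst`.

## Proof

* **Decorrelation of distinct links** (`ElitzurBessel.covariance_link_eq_zero`). For `ℓ ≠ ℓ'`
  some endpoint `v` of `ℓ` is not an endpoint of `ℓ'` and `ℓ` is not a loop
  (`ElitzurLinkCovariance.free_endpoint`, this is where `1 ≤ S` enters). The gauge rotation by
  `k ∈ G` at the single site `v` fixes `U_{ℓ'}`, maps `U_ℓ ↦ k U_ℓ` (tail) or `U_ℓ ↦ U_ℓ k⁻¹`
  (head), and leaves `μ` invariant; the Haar average of `k ↦ f(k u)`, resp. `f(u k⁻¹)`, is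
  `∫ f dHaar`, resp. `∫ f(k⁻¹) dHaar`, independently of `u` (right invariance of the Haar
  probability measure of the compact, hence unimodular, group). Elitzur averaging
  (`ElitzurLinkCovariance.covariance_eq_zero_of_siteRotation`) gives
  `Cov_μ(f(U_ℓ), h(U_{ℓ'})) = 0` for all bounded measurable `f, h : G → ℝ`.
* **From conditional expectations to functions of one link**
  (`ElitzurBessel.exists_bounded_comp_ae_eq_condExp`). `P_ℓ φ := μ[φ | σ(U_ℓ)]` is strongly
  measurable for the pull-back σ-algebra, hence `P_ℓ φ = g ∘ U_ℓ` with `g` measurable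
  (Doob–Dynkin, `StronglyMeasurable.exists_eq_measurable_comp`); it is a.e. bounded by the bound
  `M` of `φ` (`ae_bdd_abs_condExp_of_ae_bdd_abs`), so truncating `g` at `±M` gives a bounded
  measurable `f` with `f ∘ U_ℓ = P_ℓ φ` a.e.; covariances only see a.e. classes
  (`ElitzurBessel.covariance_congr_ae`). Hence `Cov_μ(P_ℓ φ, P_{ℓ'} φ) = 0` for `ℓ ≠ ℓ'`.
* **Bessel** (`ElitzurBessel.sum_variance_condExp_le`, abstract probability space). With
  `X_ℓ := P_ℓ φ` pairwise uncorrelated and `ψ := Σ_ℓ X_ℓ`: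
  `Var ψ = Σ_ℓ Σ_ℓ' Cov(X_ℓ, X_ℓ') = Σ_ℓ Var X_ℓ =: s` (`variance_fun_sum`), and
  `Cov(φ, X_ℓ) = Var X_ℓ` by the pull-out property `E[φ X_ℓ] = E[X_ℓ²]`, `E X_ℓ = E φ`
  (`ElitzurBessel.covariance_condExp_eq_variance`), so `Cov(φ, ψ) = s`. Cauchy–Schwarz for the
  covariance (`Literature.Probability.Moments.covariance_sq_le_variance_mul`) gives
  `s² ≤ Var φ · s`, whence `s ≤ Var φ`.

Sources: S. Elitzur, Phys. Rev. D 12 (1975) 3978 (local gauge-variant observables average out);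
E. Seiler, LNP 159 (1982) §1 (gauge invariance of the lattice measure). The Bessel step is the
elementary Hilbert-space inequality for a family of commuting-on-constants projections with
pairwise orthogonal centred ranges.
-/

noncomputable section

open MeasureTheory ProbabilityTheory
open Literature.MathematicalPhysics.QuantumFieldTheory

namespace Summit.QuantumFields.YangMills.Theorems.SusceptibilityToPoincare

namespace ElitzurBessel

/-! ### Abstract probability: Bessel's inequality for pairwise uncorrelated conditional
expectations -/

section Abstract

variable {Ω : Type*} {m m0 : MeasurableSpace Ω} {μ : Measure Ω}

/-- Covariances only depend on the a.e. classes of the two variables. [folklore] -/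
theorem covariance_congr_ae {X X' Y Y' : Ω → ℝ} (hX : X =ᵐ[μ] X') (hY : Y =ᵐ[μ] Y') :
    cov[X, Y; μ] = cov[X', Y'; μ] := by
  simp only [covariance]
  rw [integral_congr_ae hX, integral_congr_ae hY]
  refine integral_congr_ae ?_
  filter_upwards [hX, hY] with ω h1 h2
  rw [h1, h2]

/-- **Doob–Dynkin with truncation.** If `|φ| ≤ M` pointwise, the conditional expectation of `φ`
given the σ-algebra generated by a map `π : Ω → Y` agrees a.e. with `f ∘ π` for some measurable
`f : Y → ℝ` with `|f| ≤ M` pointwise: `μ[φ | σ(π)]` is `σ(π)`-strongly measurable, hence of the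
form `g ∘ π` with `g` measurable (`StronglyMeasurable.exists_eq_measurable_comp`), and it is a.e.
bounded by `M`, so `f := max (−M) (min M g)` works. [folklore] -/
theorem exists_bounded_comp_ae_eq_condExp {Y : Type*} [MeasurableSpace Y] {π : Ω → Y}
    {φ : Ω → ℝ} {M : ℝ} (hM0 : 0 ≤ M) (hφM : ∀ ω, |φ ω| ≤ M) :
    ∃ f : Y → ℝ, Measurable f ∧ (∀ y, |f y| ≤ M) ∧
      (fun ω => f (π ω)) =ᵐ[μ] μ[φ | MeasurableSpace.comap π inferInstance] := by
  obtain ⟨g, hg, hgeq⟩ :=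
    (stronglyMeasurable_condExp (m := MeasurableSpace.comap π inferInstance) (μ := μ)
      (f := φ)).exists_eq_measurable_comp
  refine ⟨fun y => max (-M) (min M (g y)),
    measurable_const.max (measurable_const.min hg.measurable),
    fun y => abs_le.2 ⟨le_max_left _ _, max_le (by linarith) (min_le_left _ _)⟩, ?_⟩
  have hbd : ∀ᵐ ω ∂μ, |(μ[φ | MeasurableSpace.comap π inferInstance]) ω| ≤ M :=
    ae_bdd_abs_condExp_of_ae_bdd_abs (Filter.Eventually.of_forall hφM)
  filter_upwards [hbd] with ω hω
  rw [hgeq] at hω ⊢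
  rw [Function.comp_apply] at hω ⊢
  obtain ⟨hl, hr⟩ := abs_le.1 hω
  rw [min_eq_right hr, max_eq_right hl]

variable [IsProbabilityMeasure μ]

/-- For `φ ∈ L²` and a sub-σ-algebra `m`, `Cov(φ, μ[φ|m]) = Var(μ[φ|m])`: the pull-out property
`E[φ · μ[φ|m]] = E[μ[φ|m]²]` and `E μ[φ|m] = E φ`. [folklore] -/
theorem covariance_condExp_eq_variance (hm : m ≤ m0) {φ : Ω → ℝ} (hφ : MemLp φ 2 μ) :
    cov[φ, μ[φ|m]; μ] = Var[μ[φ|m]; μ] := by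
  have hc : MemLp (μ[φ|m]) 2 μ := hφ.condExp one_le_two
  rw [← covariance_self hc.aestronglyMeasurable.aemeasurable, covariance_eq_sub hφ hc,
    covariance_eq_sub hc hc]
  have h1 : ∫ ω, μ[φ|m] ω * μ[φ|m] ω ∂μ = ∫ ω, φ ω * μ[φ|m] ω ∂μ :=
    TwoBlock.integral_condExp_mul hm hφ hc stronglyMeasurable_condExp
  have h2 : μ[μ[φ|m]] = μ[φ] := integral_condExp hm
  have h3 : μ[φ * μ[φ|m]] = ∫ ω, φ ω * μ[φ|m] ω ∂μ := rfl
  have h4 : μ[μ[φ|m] * μ[φ|m]] = ∫ ω, μ[φ|m] ω * μ[φ|m] ω ∂μ := rfl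
  rw [h3, h4, h1, h2]

/-- **Bessel's inequality for pairwise uncorrelated conditional expectations.** On a probability
space, for finitely many sub-σ-algebras `m i ≤ m0` and `φ ∈ L²` whose conditional expectations
`X_i := μ[φ | m i]` are pairwise uncorrelated, `Σ_i Var X_i ≤ Var φ`: with `ψ := Σ_i X_i` one has
`Var ψ = Σ_i Var X_i = Cov(φ, ψ)`, and `Cov(φ, ψ)² ≤ Var φ · Var ψ`. [folklore] -/
theorem sum_variance_condExp_le {ι : Type*} [Fintype ι] (m : ι → MeasurableSpace Ω)
    (hm : ∀ i, m i ≤ m0) {φ : Ω → ℝ} (hφ : MemLp φ 2 μ)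
    (horth : ∀ i j, i ≠ j → cov[μ[φ | m i], μ[φ | m j]; μ] = 0) :
    ∑ i, Var[μ[φ | m i]; μ] ≤ Var[φ; μ] := by
  set X : ι → Ω → ℝ := fun i => μ[φ | m i] with hX_def
  have hX : ∀ i, MemLp (X i) 2 μ := fun i => hφ.condExp one_le_two
  have hψ : MemLp (fun ω => ∑ i, X i ω) 2 μ := memLp_finsetSum _ fun i _ => hX i
  -- `Var ψ = s`
  have hVarψ : Var[fun ω => ∑ i, X i ω; μ] = ∑ i, Var[X i; μ] := by
    rw [variance_fun_sum hX]
    refine Finset.sum_congr rfl fun i _ => ?_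
    rw [Finset.sum_eq_single i (fun j _ hne => horth i j (Ne.symm hne)) (by simp)]
    exact covariance_self (hX i).aestronglyMeasurable.aemeasurable
  -- `Cov(φ, ψ) = s`
  have hCovψ : cov[φ, fun ω => ∑ i, X i ω; μ] = ∑ i, Var[X i; μ] := by
    rw [covariance_fun_sum_right hX hφ]
    exact Finset.sum_congr rfl fun i _ => covariance_condExp_eq_variance (hm i) hφ
  -- Cauchy–Schwarz
  have hcs := Literature.Probability.Moments.covariance_sq_le_variance_mul hφ hψ
  rw [hCovψ, hVarψ] at hcs
  have hV : 0 ≤ Var[φ; μ] := variance_nonneg _ _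
  by_contra hlt
  rw [not_le] at hlt
  have hs0 : 0 < ∑ i, Var[X i; μ] := lt_of_le_of_lt hV hlt
  have h1 : (∑ i, Var[X i; μ]) * ∑ i, Var[X i; μ] ≤ Var[φ; μ] * ∑ i, Var[X i; μ] := by
    rw [← sq]; exact hcs
  exact absurd (le_of_mul_le_mul_right h1 hs0) (not_le.2 hlt)

end Abstract

/-! ### The torus: functions of two distinct links are uncorrelated under the Wilson measure -/

section Lattice

open ElitzurLinkCovariance

/-- **Elitzur decorrelation of two distinct links.** On the torus `(ℤ/(2S+1))^d` with `S ≥ 1`, for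
the Wilson measure `μ = wilsonMeasure r.ρ β` of a compact group with a lattice representation `r`,
any real `β`, distinct links `ℓ ≠ ℓ'` and bounded measurable `f h : G → ℝ`:
`Cov_μ(f(U_ℓ), h(U_{ℓ'})) = 0`. Rotate by `k` at an endpoint of `ℓ` that is not an endpoint of
`ℓ'` (`free_endpoint`): this fixes `U_{ℓ'}`, acts on `U_ℓ` by `k ·` or `· k⁻¹`, preserves `μ`, and
the Haar average of `f` along the orbit is a constant (right invariance and unimodularity of the
Haar probability measure); conclude by `covariance_eq_zero_of_siteRotation`. [folklore] -/
theorem covariance_link_eq_zero {d S : ℕ} (hS : 1 ≤ S) {G : Type*} [Group G]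
    [TopologicalSpace G] [IsTopologicalGroup G] [CompactSpace G] [MeasurableSpace G] [BorelSpace G]
    (r : LatticeRep G) (β : ℝ) {ℓ ℓ' : Edge d (2 * S + 1)} (hne : ℓ ≠ ℓ') {f h : G → ℝ}
    (hf : Measurable f) (hh : Measurable h) {B C : ℝ} (hB : ∀ k, ‖f k‖ ≤ B)
    (hC : ∀ k, ‖h k‖ ≤ C) :
    cov[fun U : GaugeConfig d (2 * S + 1) G => f (U ℓ), fun U => h (U ℓ');
      wilsonMeasure (d := d) (L := 2 * S + 1) r.ρ β] = 0 := by
  classical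
  haveI := (r.continuous.isClosedEmbedding r.injective).isEmbedding.secondCountableTopology
  obtain ⟨hloop, hfree⟩ := free_endpoint (d := d) hS hne
  have hF : Measurable fun U : GaugeConfig d (2 * S + 1) G => f (U ℓ) :=
    hf.comp (measurable_pi_apply ℓ)
  have hY : Measurable fun U : GaugeConfig d (2 * S + 1) G => h (U ℓ') :=
    hh.comp (measurable_pi_apply ℓ')
  rcases hfree with ⟨h1, h2⟩ | ⟨h1, h2⟩
  · refine covariance_eq_zero_of_siteRotation r.ρ r.continuous β ℓ.1 hF hY (fun U => hB (U ℓ))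
      (fun U => hC (U ℓ')) (fun k U => congrArg h (gaugeTransform_update_of_ne k U h1 h2))
      (c := ∫ k, f k ∂haarProbability G) fun U => ?_
    have hk : ∀ k : G,
        gaugeTransform (Function.update (1 : Site d (2 * S + 1) → G) ℓ.1 k) U ℓ = k * U ℓ :=
      fun k => gaugeTransform_update_tail k U rfl hloop.symm
    simp only [hk]
    exact integral_mul_right_eq_self (μ := haarProbability G) f (U ℓ)
  · refine covariance_eq_zero_of_siteRotation r.ρ r.continuous β (ℓ.1.shift ℓ.2) hF hY
      (fun U => hB (U ℓ)) (fun U => hC (U ℓ'))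
      (fun k U => congrArg h (gaugeTransform_update_of_ne k U h1 h2))
      (c := ∫ k, f k⁻¹ ∂haarProbability G) fun U => ?_
    have hk : ∀ k : G, gaugeTransform
        (Function.update (1 : Site d (2 * S + 1) → G) (ℓ.1.shift ℓ.2) k) U ℓ = U ℓ * k⁻¹ :=
      fun k => gaugeTransform_update_head k U hloop rfl
    simp only [hk]
    exact integral_haar_comp_mul_inv f (U ℓ)

end Lattice

/-! ### Elitzur–Bessel for the Wilson measure, direct form -/

/-- **Elitzur–Bessel, direct form** (the statement of S2 spelled directly over
`wilsonMeasure (d := 4) (L := 2S+1) r.ρ β`, as registered for the line `planted-link-pinning` of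
crux stmt-QuantumFields-9441 in skeleton v2). For every compact group `G` with a lattice
representation `r`, every real `β`, every `S ≥ 1` and every bounded measurable `φ` on
`GaugeConfig 4 (2S+1) G`, `Σ_ℓ Var_μ(E_μ[φ | σ(U_ℓ)]) ≤ Var_μ φ` for `μ = wilsonMeasure r.ρ β`.
Distinct links are uncorrelated for arbitrary bounded observables of the single links (Elitzur
gauge averaging at a free endpoint, `covariance_link_eq_zero`), the conditional expectations given
`σ(U_ℓ)` are a.e. bounded functions of `U_ℓ` (Doob–Dynkin, `exists_bounded_comp_ae_eq_condExp`),
and pairwise uncorrelated conditional expectations satisfy Bessel's inequality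
(`sum_variance_condExp_le`). [folklore] -/
theorem stub_elitzurBessel :
    ∀ (G : Type) [Group G] [TopologicalSpace G] [IsTopologicalGroup G] [CompactSpace G]
      [MeasurableSpace G] [BorelSpace G],
      ∀ (r : Literature.MathematicalPhysics.QuantumFieldTheory.LatticeRep G) (β : ℝ) (S : ℕ), 1 ≤ S →
        ∀ φ : Literature.MathematicalPhysics.QuantumFieldTheory.GaugeConfig 4 (2 * S + 1) G → ℝ,
          Measurable φ → (∃ M : ℝ, ∀ U, |φ U| ≤ M) →
            ∑ ℓ : Literature.MathematicalPhysics.QuantumFieldTheory.Edge 4 (2 * S + 1),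
              ProbabilityTheory.variance
                ((Literature.MathematicalPhysics.QuantumFieldTheory.wilsonMeasure (d := 4)
                    (L := 2 * S + 1) r.ρ β)[φ |
                  MeasurableSpace.comap
                    (fun V : Literature.MathematicalPhysics.QuantumFieldTheory.GaugeConfig 4
                      (2 * S + 1) G => V ℓ) inferInstance])
                (Literature.MathematicalPhysics.QuantumFieldTheory.wilsonMeasure (d := 4)
                  (L := 2 * S + 1) r.ρ β) ≤
              ProbabilityTheory.variance φ
                (Literature.MathematicalPhysics.QuantumFieldTheory.wilsonMeasure (d := 4)
                  (L := 2 * S + 1) r.ρ β) := by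
  intro G _ _ _ _ _ _ r β S hS φ hφ hφb
  obtain ⟨M, hM⟩ := hφb
  haveI : IsProbabilityMeasure (wilsonMeasure (d := 4) (L := 2 * S + 1) r.ρ β) :=
    isProbabilityMeasure_wilsonMeasure (d := 4) (L := 2 * S + 1) r.ρ r.continuous β
  have hM0 : 0 ≤ M := (abs_nonneg _).trans (hM fun _ => 1)
  have hφ2 : MemLp φ 2 (wilsonMeasure (d := 4) (L := 2 * S + 1) r.ρ β) :=
    MemLp.of_bound hφ.aestronglyMeasurable M
      (ae_of_all _ fun U => by simpa only [Real.norm_eq_abs] using hM U)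
  refine sum_variance_condExp_le
    (fun ℓ => MeasurableSpace.comap (fun V : GaugeConfig 4 (2 * S + 1) G => V ℓ) inferInstance)
    (fun ℓ => (measurable_pi_apply ℓ).comap_le) hφ2 fun ℓ ℓ' hne => ?_
  obtain ⟨f, hf, hfb, hfae⟩ := exists_bounded_comp_ae_eq_condExp
    (μ := wilsonMeasure (d := 4) (L := 2 * S + 1) r.ρ β)
    (π := fun V : GaugeConfig 4 (2 * S + 1) G => V ℓ) hM0 hM
  obtain ⟨h, hh, hhb, hhae⟩ := exists_bounded_comp_ae_eq_condExp
    (μ := wilsonMeasure (d := 4) (L := 2 * S + 1) r.ρ β)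
    (π := fun V : GaugeConfig 4 (2 * S + 1) G => V ℓ') hM0 hM
  exact (covariance_congr_ae hfae hhae).symm.trans
    (covariance_link_eq_zero hS r β hne hf hh
      (fun k => by rw [Real.norm_eq_abs]; exact hfb k)
      (fun k => by rw [Real.norm_eq_abs]; exact hhb k))

end ElitzurBessel

/-! ### The registered stub -/

/-- `stub_elitzurBessel` — **S2 · Elitzur–Bessel: the unpinned torus Wilson measure is spectrally
independent with constant 1** (line `planted-link-pinning` of crux stmt-QuantumFields-9441). For
every compact group `G` with a lattice representation `r`, every real `β`, every `S ≥ 1`, the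
torus Wilson measure `μW = wilsonMeasure r.ρ β` on `GaugeConfig 4 (2S+1) G` and every bounded
measurable `φ`, `Σ_ℓ Var_μW(E_μW[φ | σ(U_ℓ)]) ≤ Var_μW φ`.
Distinct links are uncorrelated for arbitrary bounded observables of the single links (Elitzur
gauge averaging at a free endpoint, `ElitzurBessel.covariance_link_eq_zero`), the conditional
expectations given `σ(U_ℓ)` are a.e. bounded functions of `U_ℓ` (Doob–Dynkin,
`ElitzurBessel.exists_bounded_comp_ae_eq_condExp`), and pairwise uncorrelated conditional
expectations satisfy Bessel's inequality (`ElitzurBessel.sum_variance_condExp_le`); this is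
`ElitzurBessel.stub_elitzurBessel` after substituting `μW`. [folklore] -/
theorem stub_elitzurBessel :
    ∀ (G : Type) [Group G] [TopologicalSpace G] [IsTopologicalGroup G] [CompactSpace G]
      [MeasurableSpace G] [BorelSpace G] (r : LatticeRep G) (β : ℝ) (S : ℕ), 1 ≤ S →
      ∀ (μW : Measure (GaugeConfig 4 (2 * S + 1) G)),
      μW = (wilsonMeasure r.ρ β : Measure (GaugeConfig 4 (2 * S + 1) G)) →
      ∀ φ : GaugeConfig 4 (2 * S + 1) G → ℝ, Measurable φ → (∃ M : ℝ, ∀ U, |φ U| ≤ M) →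
      ∑ ℓ : Edge 4 (2 * S + 1),
          variance (μW[φ | MeasurableSpace.comap (fun V : GaugeConfig 4 (2 * S + 1) G => V ℓ) inferInstance]) μW ≤
        variance φ μW := by
  intro G _ _ _ _ _ _ r β S hS μW hμW φ hφ hφb
  subst hμW
  exact ElitzurBessel.stub_elitzurBessel G r β S hS φ hφ hφb

end Summit.QuantumFields.YangMills.Theorems.SusceptibilityToPoincare

end
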